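import Mathlib
import Summits.Ventures.PercRepro2.SwOutCubeWeak
import Summits.Ventures.PercRepro2.SwOutMultiRootThm

/-!
# The rigid inequality on a part from WEAK cubes (blind cell PercRepro2, night-4 g36, 2026-08-29;
proofs/NIGHT4-G36.md §6)

g34's block decomposition of a part (`rigidOK_g_of_blocks_part`) with the weak cube principle
(`card_le_of_cube_edges_weak`) on the blocks: if every side point `ζ` of a part `P` of the general
doubly typed side of a class `(U, ξ)` has a block which is the image of an injective cube
realisation `r` on which the side pulls back to a lower set, the red edge set of `h` is increasing,
and at every side point the red edges of `h` at the antipode are blue edges of `h` — and every side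
point of that block lies in the part with the same key — then the rigid counting inequality holds
on the part: **`rigidOK_g_of_weakCubes`**.  This is the abstract shape of the FROZEN blocks of the
impure frontier (mining/night-4/g36/blockfind.py: at `n = 7` every fibre of every open pair is a
disjoint union of such blocks with at most three coordinates, kit j326269): the frozen units are part
of the realisation's background, the coordinates are the movable units and root–root edges.
-/

namespace Summit.Ventures.PercRepro2

namespace LocRows

open Hull

universe u v

variable {V : Type u} {E : Type v} [Fintype E] [DecidableEq E]

open scoped Classical

variable {ends : E → Sym2 V} {U : Set V} {ξ : Config E} {l h : V}
  {𝓤 𝓓 𝓓'' : Set (Set V)} {X : Set V} {𝓤' : Set (Set V)}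

/-- **The rigid inequality on a part from weak cubes**: every side point of the part lies in its
block, every side point of a block lies in the part with the same key, and every block is the image
of an injective cube realisation on which the side pulls back to a lower set, the red edge set of
`h` is increasing, and the red edges of `h` at the antipode of a side point are blue edges of `h`
at the point. -/
theorem rigidOK_g_of_weakCubes {K : Type*} (key : Config E → K) (block : K → Finset (Config E))
    (P : Config E → Prop)
    (hmem : ∀ ζ ∈ gOutSide ends l h 𝓤 𝓓 𝓓'' X 𝓤' U ξ, P ζ → ζ ∈ block (key ζ))
    (hblock : ∀ ζ ∈ gOutSide ends l h 𝓤 𝓓 𝓓'' X 𝓤' U ξ, P ζ → ∀ ζ' ∈ block (key ζ),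
      ζ' ∈ gTypedQ ends l h 𝓤 𝓓 𝓓'' X 𝓤' →
        ζ' ∈ gOutSide ends l h 𝓤 𝓓 𝓓'' X 𝓤' U ξ ∧ P ζ' ∧ key ζ' = key ζ)
    (hcube : ∀ ζ ∈ gOutSide ends l h 𝓤 𝓓 𝓓'' X 𝓤' U ξ, P ζ →
      ∃ (E' : Type v) (_ : Fintype E') (_ : DecidableEq E') (r : Config E' → Config E),
        Function.Injective r ∧ (∀ ζ', ζ' ∈ block (key ζ) ↔ ∃ ω, r ω = ζ') ∧
          IsLowerSet {ω | r ω ∈ gTypedQ ends l h 𝓤 𝓓 𝓓'' X 𝓤'} ∧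
          (∀ 𝓔 : Set (Set E), IsUpperSet 𝓔 → IsUpperSet {ω | redEdges ends (r ω) h ∈ 𝓔}) ∧
          (∀ ω, r ω ∈ gTypedQ ends l h 𝓤 𝓓 𝓓'' X 𝓤' →
            redEdges ends (r (flipAll ω)) h ⊆ blueEdges ends (r ω) h))
    {𝓔 : Set (Set E)} (h𝓔 : IsUpperSet 𝓔) :
    ((gOutSide ends l h 𝓤 𝓓 𝓓'' X 𝓤' U ξ).filter fun ζ => P ζ ∧ redEdges ends ζ h ∈ 𝓔).card ≤
      ((gOutSide ends l h 𝓤 𝓓 𝓓'' X 𝓤' U ξ).filter fun ζ => P ζ ∧ blueEdges ends ζ h ∈ 𝓔).card := by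
  refine rigidOK_g_of_blocks_part key block P hmem hblock ?_ h𝓔
  intro ζ hζ hP 𝓔' h𝓔'
  obtain ⟨E', _, _, r, hr, hC, hEv, hT, hswap⟩ := hcube ζ hζ hP
  have := card_le_of_cube_edges_weak (ends := ends) r hr (block (key ζ)) hC
    {ζ' | ζ' ∈ gTypedQ ends l h 𝓤 𝓓 𝓓'' X 𝓤'} hEv h hT hswap h𝓔'
  simpa only [Set.mem_setOf_eq] using this

end LocRows

end Summit.Ventures.PercRepro2
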